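import Summits.NavierStokesRegularity.NavierStokesRegularity.Theorems.PlanarEnergyLiouville.Negative.PlanarBoundLoadBearing
import Literature.Analysis.FluidPDE.KNSSAxisymmetricNoSwirlHolds
import HarnessLib

/-!
# `PlanarEnergyLiouville`: the axisymmetric no-swirl corner, unconditionally

Route `PlaneEnergyCeiling`, crux `PlanarEnergyLiouville` (stmt-NavierStokesRegularity-16856). The
crux docstring lists the "axisymmetric-no-swirl corner (KNSS)"; this file certifies it: a bounded
ancient mild solution (`ν = 1`) with measurable slices, jointly smooth on `(−∞,0) × ℝ³`, which is
axisymmetric WITHOUT swirl on every slice and has bounded planar energies, vanishes identically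
(`planarEnergyLiouville_axisymNoSwirlCorner`, registered sub-goal of the crux item).

Proof: by Koch–Nadirashvili–Seregin–Šverák 2009, Theorem 5.2 — proved in the tree,
`knss_axisymmetric_no_swirl'_holds` — every slice is a.e. a constant vector `b(t)`; a jointly smooth
field has continuous slices, so `v(t) ≡ b(t)`; a nonzero constant has infinite planar energy
(`lintegral_enorm_sq_const_eq_top`), so the planar ceiling forces `b(t) = 0`.

## References

* G. Koch, N. Nadirashvili, G. Seregin, V. Šverák, Acta Math. 203 (2009), Thm. 5.2
  (arXiv:0709.3599, pp. 9–10). [KochNadirashviliSereginSverak2009]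
-/

-- Sub = summit for this single-conjunct summit: the duplicate namespace component is deliberate.
set_option linter.dupNamespace false

noncomputable section

open MeasureTheory Set Filter Function
open scoped ENNReal NNReal
open Literature.Analysis Literature.Analysis.FluidPDE

namespace Summit.NavierStokesRegularity.NavierStokesRegularity.Theorems.PlaneEnergyCeilingPlanarEnergyLiouville

/-- **A continuous slice that is a.e. constant and has one finite planar energy is zero.** If
`w : ℝ³ → ℝ³` is continuous, `w = b` a.e., and the planar energy of `w` through the coordinate plane
`{x₂ = c}` is `≤ M < ∞` for some `c`, then `w ≡ 0`. [folklore] -/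
theorem eq_zero_of_ae_const_of_planar {w : EuclideanSpace ℝ (Fin 3) → EuclideanSpace ℝ (Fin 3)}
    (hw : Continuous w) {b : EuclideanSpace ℝ (Fin 3)} (hae : w =ᵐ[volume] fun _ => b) {M : ℝ}
    {c : ℝ} (hpl : ∫⁻ y : EuclideanSpace ℝ (Fin 2), ‖w (WithLp.toLp 2 ![y 0, y 1, c])‖ₑ ^ 2 ≤
      ENNReal.ofReal M) :
    ∀ x, w x = 0 := by
  have heq : w = fun _ => b := (Continuous.ae_eq_iff_eq volume hw continuous_const).1 hae
  have hb : b = 0 := by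
    by_contra hb
    have h : ∫⁻ _ : EuclideanSpace ℝ (Fin 2), ‖b‖ₑ ^ 2 ≤ ENNReal.ofReal M := by
      simpa only [heq] using hpl
    rw [PlanarEnergyLiouvilleNegative.lintegral_enorm_sq_const_eq_top hb] at h
    exact ENNReal.ofReal_ne_top (top_le_iff.1 h)
  intro x
  rw [heq, hb]

/-- **`PlanarEnergyLiouville` in the axisymmetric no-swirl class (unconditional; registered
sub-goal of stmt-NavierStokesRegularity-16856).** A bounded ancient mild solution (`ν = 1`, KNSS
duality class) with measurable slices, jointly smooth on `(−∞,0) × ℝ³`, axisymmetric without swirl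
on every slice `t < 0`, whose planar kinetic energies are bounded on every plane and every slice,
vanishes identically: KNSS 2009 Thm. 5.2 (`knss_axisymmetric_no_swirl'_holds`) makes every slice
a.e. constant, continuity makes it constant, and a nonzero constant has infinite planar energy.
[cite: KochNadirashviliSereginSverak2009, Thm 5.2 (arXiv pp. 9–10)] -/
theorem planarEnergyLiouville_axisymNoSwirlCorner :
    ∀ (v : ℝ → EuclideanSpace ℝ (Fin 3) → EuclideanSpace ℝ (Fin 3)),
      Literature.Analysis.FluidPDE.IsBoundedAncientMildSolution 1 v →
      (∀ t < 0, MeasureTheory.AEStronglyMeasurable (v t) MeasureTheory.volume) →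
      ContDiffOn ℝ (⊤ : ℕ∞) (Function.uncurry v) (Set.Iio 0 ×ˢ Set.univ) →
      (∀ t < 0, Literature.Analysis.FluidPDE.IsAxisymmetric (v t)) →
      (∀ t < 0, Literature.Analysis.FluidPDE.HasNoSwirl (v t)) →
      (∃ M : ℝ, ∀ t < 0, ∀ (R : EuclideanSpace ℝ (Fin 3) ≃ₗᵢ[ℝ] EuclideanSpace ℝ (Fin 3)) (c : ℝ),
        ∫⁻ y : EuclideanSpace ℝ (Fin 2), ‖v t (R (WithLp.toLp 2 ![y 0, y 1, c]))‖ₑ ^ 2 ≤ ENNReal.ofReal M) →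
      ∀ t < 0, ∀ x, v t x = 0 := by
  intro v hv hmeas hsm haxi hsw hpl t ht x
  obtain ⟨M, hM⟩ := hpl
  obtain ⟨b, hb⟩ := knss_axisymmetric_no_swirl'_holds hv hmeas haxi hsw t ht
  have hcont : Continuous (v t) := PlanarEnergyLiouvilleNegative.continuous_slice_of_contDiffOn hsm ht
  have hplt : ∫⁻ y : EuclideanSpace ℝ (Fin 2), ‖v t (WithLp.toLp 2 ![y 0, y 1, 0])‖ₑ ^ 2 ≤
      ENNReal.ofReal M := by
    simpa using hM t ht (LinearIsometryEquiv.refl ℝ (EuclideanSpace ℝ (Fin 3))) 0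
  exact eq_zero_of_ae_const_of_planar hcont hb hplt x

end Summit.NavierStokesRegularity.NavierStokesRegularity.Theorems.PlaneEnergyCeilingPlanarEnergyLiouville

end
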